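import Summits.BirchSwinnertonDyer.BirchSwinnertonDyer.Theorems.AlignedTransportAtTwoBSDOfMainConjectureRankOneAtTwoSigmaSqTwoFieldVeluFE
import Summits.BirchSwinnertonDyer.BirchSwinnertonDyer.Theorems.AlignedTransportAtTwoBSDOfMainConjectureRankOneAtTwoSigmaSqTwoODEFamily
import Literature.NumberTheory.EllipticCurves.FormalLogExpBaseChangeProofs
import Mathlib.RingTheory.Localization.FractionRing
import HarnessLib

/-!
# The squared `2`-isogeny functional equation over a `ℚ`-ALGEBRA DOMAIN (e.g. `K₂ = R̂₂[1/2]`), by passage to the fraction field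
# (step S6 glue of the discharge plan for the PRINT stub `stub_sigmaSqTwo`)

Cell `bsd-f1-sign2`, WIDTH-5 attach seat `bsd-line-att-p3` g8 (`--supports stmt-BirchSwinnertonDyer-23008`; plan
`Cruxes/BSDOfMainConjectureRankOneAtTwo/SIGMASQ-AT-TWO-att-p3.md`, §7/S6). THEOREMS ONLY; route-independent. BSD is not proved by any of this.

The field-general functional equation (`….SigmaSqTwo.Field.X_sq_mul_sq_subst_eq_of_twoIsogeny`, `…FieldIsogenyFE.lean`; its proof divides by
series with non-zero constant term and uses rigidity, hence wants a field) is transported to any `ℚ`-algebra DOMAIN `K`: map every datum along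
`ι : K → Frac(K)` (`isFormallyOdd_map_ringHom`, `satisfiesSigmaODE_map_ringHom` of `…ODEFamily.lean`; `map_formalLog`, `map_formalXMulSq`,
`powerSeries_map_subst`), apply the field version in `Frac(K)⟦z⟧`, and pull the identity back along the injection `K⟦z⟧ → Frac(K)⟦z⟧`. The universal
Dwork step runs over `K₂ = completeRingQ` (`Literature…PadicSigmaSqTwo.Universal.isDomain_completeRingQ`), where this is the form needed.

* `X_sq_mul_sq_subst_eq_of_twoIsogeny_domain` — two curves `V, V'` over a `ℚ`-algebra domain, `log_{V'}(T) = π log_V`, …, `r₀ + π²c' − 2c − e = 0`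
  ⟹ `z²·σ'(T)² = π²σ⁴(X − ez²)`;
* `velu_two_X_sq_mul_sq_subst_eq_domain` — Vélu's quotient by a `2`-torsion point and ANY model `vc • V'`, all geometric inputs discharged
  (`velu_two_formalLog_transport`, `velu_two_x_transport` are already ring-general), remaining hypothesis `−r + u²c'' − 2c − e = 0`;
* `velu_two_sq_subst_mul_X_sq_eq_domain` — the same in sigma-squared currency.

## Sources
B. Perrin-Riou, Mém. SMF 17 (1984) Ch. III §1.2 Lemme 3 (ii) [cite: Perrinriou1984, Ch. III §1.2 Lemme 3 (ii)]; C. Blakestad, D. Grant,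
J. Number Theory 249 (2023) Prop. 13 [cite: BlakestadGrant2023, Prop. 13]; J. H. Silverman, Math. Ann. 332 (2005) §5 Rem. 2
[cite: Silverman2005DivPoly, §5 Rem. 2].
-/

noncomputable section

set_option linter.dupNamespace false
set_option autoImplicit false

open scoped Classical
open PowerSeries WeierstrassCurve Literature.NumberTheory.EllipticCurves Literature.RingTheory.FormalGroups

namespace Summit.BirchSwinnertonDyer.BirchSwinnertonDyer.Theorems.AlignedTransportAtTwoSigmaSqTwo

section Domain

variable {K : Type*} [CommRing K] [Algebra ℚ K] [IsDomain K] (V V' : WeierstrassCurve K)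

/-- **The squared `2`-isogeny functional equation (two curves) over a `ℚ`-algebra domain**: hypotheses and conclusion as in
`Field.X_sq_mul_sq_subst_eq_of_twoIsogeny`, base ring any `ℚ`-algebra domain (proof: base change to the fraction field and back).
[cite: Perrinriou1984, Ch. III §1.2 Lemme 3 (ii)] [cite: BlakestadGrant2023, Prop. 13] -/
theorem X_sq_mul_sq_subst_eq_of_twoIsogeny_domain {σ σ' T : K⟦X⟧} {c c' π e t r₀ : K}
    (hσ0 : constantCoeff σ = 0) (hσ1 : coeff 1 σ = 1) (hodd : V.IsFormallyOdd σ) (hODE : V.SatisfiesSigmaODE σ c)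
    (hσ0' : constantCoeff σ' = 0) (hσ1' : coeff 1 σ' = 1) (hodd' : V'.IsFormallyOdd σ')
    (hODE' : V'.SatisfiesSigmaODE σ' c') (hT0 : constantCoeff T = 0)
    (hlog : V'.formalLog.subst T = C π * V.formalLog) (hπ : π ≠ 0)
    (he : 4 * e ^ 3 + V.b₂ * e ^ 2 + 2 * V.b₄ * e + V.b₆ = 0) (ht : 2 * t = 6 * e ^ 2 + V.b₂ * e + V.b₄)
    (hx : C π ^ 2 * V'.formalXMulSq.subst T * (X ^ 2 * (V.formalXMulSq - C e * X ^ 2)) =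
      T ^ 2 * (V.formalXMulSq * (V.formalXMulSq - C e * X ^ 2) + C t * X ^ 4 +
        C r₀ * X ^ 2 * (V.formalXMulSq - C e * X ^ 2)))
    (hκ : r₀ + π ^ 2 * c' - 2 * c - e = 0) :
    X ^ 2 * σ'.subst T ^ 2 = C π ^ 2 * σ ^ 4 * (V.formalXMulSq - C e * X ^ 2) := by
  let L := FractionRing K
  let ι : K →+* L := algebraMap K L
  have hι : Function.Injective ι := IsFractionRing.injective K L
  haveI : CharZero K := algebraRat.charZero K
  haveI : CharZero L := charZero_of_injective_algebraMap hι
  have hs : HasSubst T := HasSubst.of_constantCoeff_zero' hT0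
  have hm0 : ∀ {g : K⟦X⟧}, constantCoeff g = 0 → constantCoeff (PowerSeries.map ι g) = 0 := fun {g} hg => by
    rw [← coeff_zero_eq_constantCoeff_apply, coeff_map, coeff_zero_eq_constantCoeff_apply, hg, map_zero]
  have hm1 : ∀ {g : K⟦X⟧}, coeff 1 g = 1 → coeff 1 (PowerSeries.map ι g) = 1 := fun {g} hg => by
    rw [coeff_map, hg, map_one]
  have hlog' : (V'.map ι).formalLog.subst (PowerSeries.map ι T) = C (ι π) * (V.map ι).formalLog := by
    have h := congrArg (PowerSeries.map ι) hlog
    rwa [Literature.NumberTheory.EllipticCurves.powerSeries_map_subst hs ι, map_formalLog, map_mul, map_C,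
      map_formalLog] at h
  have hπ' : ι π ≠ 0 := (map_ne_zero_iff ι hι).mpr hπ
  have he' : 4 * ι e ^ 3 + (V.map ι).b₂ * ι e ^ 2 + 2 * (V.map ι).b₄ * ι e + (V.map ι).b₆ = 0 := by
    have h := congrArg ι he
    simp only [map_add, map_mul, map_pow, map_ofNat, map_zero] at h
    simpa only [map_b₂, map_b₄, map_b₆] using h
  have ht' : 2 * ι t = 6 * ι e ^ 2 + (V.map ι).b₂ * ι e + (V.map ι).b₄ := by
    have h := congrArg ι ht
    simp only [map_add, map_mul, map_pow, map_ofNat] at h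
    simpa only [map_b₂, map_b₄] using h
  have hx' : C (ι π) ^ 2 * (V'.map ι).formalXMulSq.subst (PowerSeries.map ι T) *
      (X ^ 2 * ((V.map ι).formalXMulSq - C (ι e) * X ^ 2)) =
      PowerSeries.map ι T ^ 2 * ((V.map ι).formalXMulSq * ((V.map ι).formalXMulSq - C (ι e) * X ^ 2) + C (ι t) * X ^ 4 +
        C (ι r₀) * X ^ 2 * ((V.map ι).formalXMulSq - C (ι e) * X ^ 2)) := by
    have h := congrArg (PowerSeries.map ι) hx
    simp only [map_mul, map_pow, map_sub, map_add, map_C, map_X, map_formalXMulSq,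
      Literature.NumberTheory.EllipticCurves.powerSeries_map_subst hs ι] at h
    exact h
  have hκ' : ι r₀ + ι π ^ 2 * ι c' - 2 * ι c - ι e = 0 := by
    have h := congrArg ι hκ
    simp only [map_add, map_sub, map_mul, map_pow, map_ofNat, map_zero] at h
    exact h
  have key := Field.X_sq_mul_sq_subst_eq_of_twoIsogeny (V.map ι) (V'.map ι) (hm0 hσ0) (hm1 hσ1)
    (isFormallyOdd_map_ringHom ι hodd) (satisfiesSigmaODE_map_ringHom ι hσ0 hσ1 hODE) (hm0 hσ0') (hm1 hσ1')
    (isFormallyOdd_map_ringHom ι hodd') (satisfiesSigmaODE_map_ringHom ι hσ0' hσ1' hODE') (hm0 hT0) hlog' hπ' he' ht' hx' hκ'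
  apply PowerSeries.map_injective ι hι
  simp only [map_mul, map_pow, map_sub, map_C, map_X, map_formalXMulSq,
    Literature.NumberTheory.EllipticCurves.powerSeries_map_subst hs ι]
  exact key

/-- **The squared `2`-isogeny functional equation for Vélu's quotient over a `ℚ`-algebra domain**, geometric inputs discharged:
hypotheses and conclusion as in `velu_two_X_sq_mul_sq_subst_eq` (`ℚ_p`) / `Field.velu_two_X_sq_mul_sq_subst_eq`, base ring any
`ℚ`-algebra domain. [cite: BlakestadGrant2023, Prop. 13] [cite: Silverman2005DivPoly, §5 Rem. 2] -/
theorem velu_two_X_sq_mul_sq_subst_eq_domain {e f t : K}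
    (hQ : f ^ 2 + V.a₁ * e * f + V.a₃ * f = e ^ 3 + V.a₂ * e ^ 2 + V.a₄ * e + V.a₆)
    (h2 : 2 * f + V.a₁ * e + V.a₃ = 0) (ht : t = 3 * e ^ 2 + 2 * V.a₂ * e + V.a₄ - V.a₁ * f)
    {A M Dn u τ P : K⟦X⟧} (hA : A = V.formalXMulSq - C e * X ^ 2) (hM : M = V.formalXMulSq * A + C t * X ^ 4)
    (hDn : Dn = V.formalXMulSq * A ^ 2 + C t * X ^ 4 * (C V.a₁ * X * A - V.formalXMulSq - C f * X ^ 3))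
    (hu : Dn * u = 1) (hτ : τ = X * A * M * u) (hP : P = A * M ^ 3 * u ^ 2)
    (V' : WeierstrassCurve K) (h1' : V'.a₁ = V.a₁) (h2' : V'.a₂ = V.a₂) (h3' : V'.a₃ = V.a₃)
    (h4' : V'.a₄ = V.a₄ - 5 * t) (h6' : V'.a₆ = V.a₆ - V.b₂ * t - 7 * e * t)
    (vc : VariableChange K) {T : K⟦X⟧} (hT : T = (V'.formalVariableChange vc).subst τ)
    {σ σ'' : K⟦X⟧} {c c'' : K}
    (hσ0 : constantCoeff σ = 0) (hσ1 : coeff 1 σ = 1) (hodd : V.IsFormallyOdd σ) (hODE : V.SatisfiesSigmaODE σ c)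
    (hσ0'' : constantCoeff σ'' = 0) (hσ1'' : coeff 1 σ'' = 1) (hodd'' : (vc • V').IsFormallyOdd σ'')
    (hODE'' : (vc • V').SatisfiesSigmaODE σ'' c'')
    (hκ : -vc.r + (vc.u : K) ^ 2 * c'' - 2 * c - e = 0) :
    X ^ 2 * σ''.subst T ^ 2 = C (vc.u : K) ^ 2 * σ ^ 4 * (V.formalXMulSq - C e * X ^ 2) := by
  haveI : CharZero K := algebraRat.charZero K
  have he := twoTorsionPolynomial_eq_zero_of_point V hQ h2
  have ht2 := two_mul_velu_t V h2 ht
  have hlog := velu_two_formalLog_transport V hQ h2 ht hA hM hDn hu hτ hP V' h1' h2' h3' h4' h6' vc hT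
  have hx := velu_two_x_transport V hQ h2 ht hA hM hDn hu hτ V' h1' h2' h3' h4' h6' vc hT
  have hT0 : constantCoeff T = 0 := by
    have hτ0 : constantCoeff τ = 0 := by
      rw [hτ, map_mul, map_mul, map_mul, constantCoeff_X]; ring
    rw [hT, Literature.RingTheory.FormalGroups.constantCoeff_subst_of_constantCoeff_eq_zero hτ0,
      constantCoeff_formalVariableChange]
  have hπ : (vc.u : K) ≠ 0 := vc.u.ne_zero
  exact X_sq_mul_sq_subst_eq_of_twoIsogeny_domain V (vc • V') hσ0 hσ1 hodd hODE hσ0'' hσ1'' hodd'' hODE'' hT0 hlog hπ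
    he ht2 hx hκ

/-- Sigma-squared currency over a `ℚ`-algebra domain: `Σ''(T)·z² = u²·Σ²·(X − ez²)`. [cite: Silverman2005DivPoly, §5 Rem. 2] -/
theorem velu_two_sq_subst_mul_X_sq_eq_domain {e f t : K}
    (hQ : f ^ 2 + V.a₁ * e * f + V.a₃ * f = e ^ 3 + V.a₂ * e ^ 2 + V.a₄ * e + V.a₆)
    (h2 : 2 * f + V.a₁ * e + V.a₃ = 0) (ht : t = 3 * e ^ 2 + 2 * V.a₂ * e + V.a₄ - V.a₁ * f)
    {A M Dn u τ P : K⟦X⟧} (hA : A = V.formalXMulSq - C e * X ^ 2) (hM : M = V.formalXMulSq * A + C t * X ^ 4)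
    (hDn : Dn = V.formalXMulSq * A ^ 2 + C t * X ^ 4 * (C V.a₁ * X * A - V.formalXMulSq - C f * X ^ 3))
    (hu : Dn * u = 1) (hτ : τ = X * A * M * u) (hP : P = A * M ^ 3 * u ^ 2)
    (V' : WeierstrassCurve K) (h1' : V'.a₁ = V.a₁) (h2' : V'.a₂ = V.a₂) (h3' : V'.a₃ = V.a₃)
    (h4' : V'.a₄ = V.a₄ - 5 * t) (h6' : V'.a₆ = V.a₆ - V.b₂ * t - 7 * e * t)
    (vc : VariableChange K) {T : K⟦X⟧} (hT : T = (V'.formalVariableChange vc).subst τ)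
    {σ σ'' : K⟦X⟧} {c c'' : K}
    (hσ0 : constantCoeff σ = 0) (hσ1 : coeff 1 σ = 1) (hodd : V.IsFormallyOdd σ) (hODE : V.SatisfiesSigmaODE σ c)
    (hσ0'' : constantCoeff σ'' = 0) (hσ1'' : coeff 1 σ'' = 1) (hodd'' : (vc • V').IsFormallyOdd σ'')
    (hODE'' : (vc • V').SatisfiesSigmaODE σ'' c'')
    (hκ : -vc.r + (vc.u : K) ^ 2 * c'' - 2 * c - e = 0) :
    (σ'' ^ 2).subst T * X ^ 2 = C (vc.u : K) ^ 2 * (σ ^ 2) ^ 2 * (V.formalXMulSq - C e * X ^ 2) := by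
  have h := velu_two_X_sq_mul_sq_subst_eq_domain V hQ h2 ht hA hM hDn hu hτ hP V' h1' h2' h3' h4' h6' vc hT hσ0 hσ1 hodd
    hODE hσ0'' hσ1'' hodd'' hODE'' hκ
  have hT0 : constantCoeff T = 0 := by
    have hτ0 : constantCoeff τ = 0 := by
      rw [hτ, map_mul, map_mul, map_mul, constantCoeff_X]; ring
    rw [hT, Literature.RingTheory.FormalGroups.constantCoeff_subst_of_constantCoeff_eq_zero hτ0,
      constantCoeff_formalVariableChange]
  rw [subst_pow (HasSubst.of_constantCoeff_zero' hT0)]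
  linear_combination h

end Domain

end Summit.BirchSwinnertonDyer.BirchSwinnertonDyer.Theorems.AlignedTransportAtTwoSigmaSqTwo
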